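import Literature.AlgebraicGeometry.Motives.CurveLinearSystemMorphism
import HarnessLib

/-!
# Signed families of divisors `Σ_m pr_{0,φ m}^* Δ − Σ_m pr_{0,φ' m}^* Δ` on `C × B` and their fibres

For a smooth projective curve `C` over a field `K`, a `K`-scheme `B` and two finite families of
`K`-morphisms `φ : Fin M → (B → C)`, `φ' : Fin M' → (B → C)`, the Cartier divisor

  `D(φ, φ') = Σ_m (𝟙 × φ_m)^* Δ − Σ_m (𝟙 × φ'_m)^* Δ`   on `C × B`

(class pullbacks of the diagonal `Δ ⊆ C × C`, `Motives/CurveDiagonalDivisor`; the negative of a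
Cartier divisor is the tree's `-D = (U i, f i⁻¹)` of `Motives/AbelianVarietyTheoremOfCube`) is
the relative divisor whose fibre over a point `b` of `B` is `Σ_m [φ_m(b)] − Σ_m [φ'_m(b)]` — with
the `φ`'s coordinate projections of `B = Cᴺ` these are Milne's `D = Σ Dᵢ` of *Jacobian Varieties*,
Example 3.12, now with SIGNS, and with the `φ`'s constant maps through rational points they add
fixed divisors. This file computes the fibres over field-valued points `b : Spec L → B`:

* `CurvePlaces.signedFamily_fieldPoint_linEquiv` — `D(φ, φ')|_{C × {b}} ∼ Σ_m Δ|_{C×{φ_m b}} −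
  Σ_m Δ|_{C×{φ'_m b}}` (class pullback is additive and commutes with negatives up to linear
  equivalence; `diagonalFibre_linEquiv_classPullback`);
* `CurvePlaces.toDivisor_signedFibre`, `CurvePlaces.h0_signedFamily_fieldPoint` —
  `h⁰(C_L, D(φ, φ')_b) = ℓ(Σ_m place(φ_m b) − Σ_m place(φ'_m b))` over `L` (`h0_eq_ell`);
* bookkeeping: `CartierDivisor.ordAt_neg`, `CartierDivisor.neg_sumDivisor_linEquiv`,
  `CurvePlaces.toDivisor_neg`, `CurvePlaces.whiskerLeft_left_comp`, and
  `CurvePlaces.coordDivisorAt_eq_of_mk_eq` (`K`-points of `Cᵍ` with the same image in `C⁽ᵍ⁾`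
  have the same coordinate divisor).

These are the fibre computations (`hD`) required by the master theorem
`exists_hom_symPowProj_of_family` of `Motives/CurveLinearSystemMorphism` in Weil's construction of
the Jacobian (Milne §7). Everything is proved; no definitions, no named facts.

## References

* J. S. Milne, *Jacobian Varieties*, in Cornell–Silverman (eds.), *Arithmetic Geometry* (1986),
  §3 Example 3.12, §4 (proof of Prop. 4.2), §7. [Milne1986JacobianVarieties]
* U. Görtz, T. Wedhorn, *Algebraic Geometry I*, 2nd ed. (2020), (11.9), Prop. 11.21. [GortzWedhorn2020]
-/

noncomputable section

open CategoryTheory CategoryTheory.Limits AlgebraicGeometry IsLocalRing Order TopologicalSpace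
  MonoidalCategory CartesianMonoidalCategory

universe u

namespace Literature.AlgebraicGeometry.Motives

open Literature.AlgebraicGeometry.RelativeSpec

/-! ### Orders and negatives -/

namespace CartierDivisor

open RatFn

variable {X : Scheme.{u}} [IsIntegral X] [IsLocallyNoetherian X]

/-- `ord_x(-D) = -ord_x(D)`. [folklore] -/
theorem ordAt_neg (D : CartierDivisor X) (x : X) : (-D).ordAt x = -D.ordAt x := by
  have h := ordAt_add D (-D) x
  rw [(add_neg_sameDivisor D).ordAt_eq, ordAt_zero] at h
  omega

omit [IsLocallyNoetherian X] in
/-- `sumDivisor` of negatives respects linear equivalence termwise with signs: `-(Σ Dᵢ) ≈ Σ (-Dᵢ)`. [folklore] -/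
theorem neg_sumDivisor_linEquiv : {n : ℕ} → (D : Fin n → CartierDivisor X) →
    (-(sumDivisor D)).LinEquiv (sumDivisor fun i ↦ -(D i))
  | 0, _ => by
    change (-(0 : CartierDivisor X)).LinEquiv 0
    exact ((add_zero_sameDivisor (-(0 : CartierDivisor X))).symm.trans (neg_add_sameDivisor 0)).linEquiv
  | _ + 1, D => by
    rw [sumDivisor_succ, sumDivisor_succ]
    exact (neg_add_rev_sameDivisor _ _).linEquiv.trans ((LinEquiv.refl _).add (neg_sumDivisor_linEquiv _))

end CartierDivisor

namespace CurvePlaces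

open RatFn FieldPoint CartierDivisor Literature.NumberTheory.DiophantineGeometry
  Literature.NumberTheory.DiophantineGeometry.AlgFunctionField

variable {K : Type u} [Field K]

section Curve

variable (C : SchemeOver K) [IsIntegral C.left] [SmoothOfRelativeDimension 1 C.hom] [IsProper C.hom]

/-- `toDivisor (-D) = -toDivisor D`. [folklore] -/
theorem toDivisor_neg (D : CartierDivisor C.left) : toDivisor C (-D) = -toDivisor C D := by
  ext v
  simp [CartierDivisor.ordAt_neg]

end Curve

/-! ### Signed families `Σ_m pr_{0,π m}^* Δ − Σ_m pr_{0,π' m}^* Δ` on `C × B` -/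

section Signed

variable (C : SchemeOver K) [IsIntegral C.left] [SmoothOfRelativeDimension 1 C.hom] [IsProper C.hom]
  [GeometricallyIntegral C.hom] (B : SchemeOver K) [IsIntegral (C ⊗ B).left]
  {M M' : ℕ} (φ : Fin M → (B ⟶ C)) (φ' : Fin M' → (B ⟶ C))
  {L : Type u} [Field L] (σ : Spec (.of L) ⟶ Spec (.of K)) (b : Over.mk σ ⟶ B)

omit [IsIntegral C.left] [SmoothOfRelativeDimension 1 C.hom] [IsProper C.hom] [GeometricallyIntegral C.hom]
  [IsIntegral (C ⊗ B).left] in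
/-- The fibre inclusion of `b` followed by `C × φ` is the fibre inclusion of `b ≫ φ`. [folklore] -/
theorem whiskerLeft_left_comp (ψ : B ⟶ C) : (C ◁ b).left ≫ (C ◁ ψ).left = fibreIncl C σ (b ≫ ψ) := by
  change (C ◁ b ≫ C ◁ ψ).left = (C ◁ (b ≫ ψ)).left
  rw [← MonoidalCategory.whiskerLeft_comp]

/-- **The fibre of the signed family over a field-valued point `b` of `B`**:
`(Σ_m pr^*_{φ m} Δ − Σ_m pr^*_{φ' m} Δ)|_{C × {b}} ∼ Σ_m Δ|_{C × {b φ_m}} − Σ_m Δ|_{C × {b φ'_m}}`.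
[cite: Milne1986JacobianVarieties, §3 Example 3.12] -/
theorem signedFamily_fieldPoint_linEquiv :
    (((sumDivisor fun m ↦ (diagonalDivisor C).classPullback (C ◁ φ m).left) +
        -(sumDivisor fun m ↦ (diagonalDivisor C).classPullback (C ◁ φ' m).left)).classPullback
          (C ◁ b).left).LinEquiv
      ((sumDivisor fun m ↦ diagonalFibre C σ (b ≫ φ m)) +
        -(sumDivisor fun m ↦ diagonalFibre C σ (b ≫ φ' m))) := by
  have key : ∀ ψ : B ⟶ C, (((diagonalDivisor C).classPullback (C ◁ ψ).left).classPullback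
      (C ◁ b).left).LinEquiv (diagonalFibre C σ (b ≫ ψ)) := fun ψ ↦ by
    refine ((diagonalDivisor C).classPullback_comp_linEquiv (C ◁ ψ).left (C ◁ b).left).symm.trans ?_
    rw [whiskerLeft_left_comp]
    exact (diagonalFibre_linEquiv_classPullback C _ _).symm
  refine (classPullback_add_linEquiv _ _ _).trans (LinEquiv.add ?_ ?_)
  · exact (classPullback_sumDivisor_linEquiv _ _).trans (sumDivisor_linEquiv fun m ↦ key (φ m))
  · refine (classPullback_neg_linEquiv _ _).trans (LinEquiv.neg ?_)
    exact (classPullback_sumDivisor_linEquiv _ _).trans (sumDivisor_linEquiv fun m ↦ key (φ' m))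

omit [IsIntegral (C ⊗ B).left] in
/-- **`toDivisor` of the fibre**: `Σ_m place(b φ_m) − Σ_m place(b φ'_m)`. [cite: Milne1986JacobianVarieties, §3 Example 3.12] -/
theorem toDivisor_signedFibre :
    toDivisor (curveBC C σ) ((sumDivisor fun m ↦ diagonalFibre C σ (b ≫ φ m)) +
        -(sumDivisor fun m ↦ diagonalFibre C σ (b ≫ φ' m))) =
      (∑ m, Finsupp.single (place (curveBC C σ) (ratPtPoint C σ (b ≫ φ m))
          (ratPtPoint_ne_genericPoint C _ _)) 1) -
        ∑ m, Finsupp.single (place (curveBC C σ) (ratPtPoint C σ (b ≫ φ' m))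
          (ratPtPoint_ne_genericPoint C _ _)) 1 := by
  have h1 := toDivisor_add (curveBC C σ) (sumDivisor fun m ↦ diagonalFibre C σ (b ≫ φ m))
    (-(sumDivisor fun m ↦ diagonalFibre C σ (b ≫ φ' m)))
  have h2 := toDivisor_neg (curveBC C σ) (sumDivisor fun m ↦ diagonalFibre C σ (b ≫ φ' m))
  have h3 := toDivisor_sumDivisor (curveBC C σ) (fun m ↦ diagonalFibre C σ (b ≫ φ m))
  have h4 := toDivisor_sumDivisor (curveBC C σ) (fun m ↦ diagonalFibre C σ (b ≫ φ' m))
  refine h1.trans ((congrArg₂ (· + ·) h3 h2).trans ?_)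
  rw [h4, ← sub_eq_add_neg]
  congr 1
  · exact Finset.sum_congr rfl fun m _ ↦ toDivisor_diagonalFibre C _ _
  · exact Finset.sum_congr rfl fun m _ ↦ toDivisor_diagonalFibre C _ _

/-- **`h⁰` of the signed family at a field-valued point** `b : Spec L → B`:
`h⁰ = ℓ(Σ_m [b φ_m] − Σ_m [b φ'_m])` over `L`. [cite: Milne1986JacobianVarieties, §3 Example 3.12 and §4 (proof of Prop. 4.2)] -/
theorem h0_signedFamily_fieldPoint :
    letI := fibreOverField C σ
    (((sumDivisor fun m ↦ (diagonalDivisor C).classPullback (C ◁ φ m).left) +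
        -(sumDivisor fun m ↦ (diagonalDivisor C).classPullback (C ◁ φ' m).left)).classPullback
          (C ◁ b).left).h0 L =
      ell ((∑ m, Finsupp.single (place (curveBC C σ) (ratPtPoint C σ (b ≫ φ m))
          (ratPtPoint_ne_genericPoint C _ _)) 1) -
        ∑ m, Finsupp.single (place (curveBC C σ) (ratPtPoint C σ (b ≫ φ' m))
          (ratPtPoint_ne_genericPoint C _ _)) 1) := by
  letI := fibreOverField C σ
  rw [(signedFamily_fieldPoint_linEquiv C B φ φ' σ b).h0_eq (K := L), ← toDivisor_signedFibre]
  exact h0_eq_ell (C := curveBC C σ) _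

end Signed

/-! ### `K`-points of `Cᵍ` over the same point of `C⁽ᵍ⁾` -/

section SamePoint

variable (C : SchemeOver K) [SmoothOfRelativeDimension 1 C.hom] [IsProper C.hom]
  [GeometricallyIntegral C.hom] (g : ℕ) (hC : IsProjectiveOver C)

/-- **`K`-points of `Cᵍ` with the same image in `C⁽ᵍ⁾(K)` have the same coordinate divisor**
(algebraically closed `K`): the fibres of `Cᵍ → C⁽ᵍ⁾` are the `𝔖_g`-orbits (`symPowProj.mk_eq_iff`)
and the coordinate divisor is symmetric (`coordDivisorAt_permOver`). [cite: Milne1986JacobianVarieties, §3 Prop. 3.1] -/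
theorem coordDivisorAt_eq_of_mk_eq [IsAlgClosed K] {τ τ' : AlgPoints (powC C g) K}
    (h : τ ≫ symPowProj.mk C hC g = τ' ≫ symPowProj.mk C hC g) :
    coordDivisorAt C g (strPt (K := K) K) τ = coordDivisorAt C g (strPt (K := K) K) τ' := by
  have hpt : (symPowProj.mk C hC g).left τ.pt = (symPowProj.mk C hC g).left τ'.pt := by
    rw [← AlgPoints.pt_comp, ← AlgPoints.pt_comp, h]
  obtain ⟨σ, hσ⟩ := (symPowProj.mk_eq_iff C hC g _ _).mp hpt
  have hτ : τ ≫ permOver C.hom g σ = τ' := by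
    apply AlgPoints.eq_of_pt_eq
    rw [AlgPoints.pt_comp]
    exact hσ
  rw [← hτ, coordDivisorAt_permOver]

end SamePoint

end CurvePlaces

end Literature.AlgebraicGeometry.Motives

end
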